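import Summits.QuantumFields.GaugeBoot.Certificates.N1c2D3TabA
import Summits.QuantumFields.GaugeBoot.Certificates.N1c2D3TabB
import HarnessLib

/-!
# Kernel checks of the reduced problem family `N1c2D3` (assembly + interface) (gb_lean_emit_reduced 0.8.2)

HONEST FRAMING (cell `pub-gaugeboot`): certified bounds on lattice expectations at stated coupling,
gauge group, dimension and torus size; NOT a mass gap, NOT a continuum limit, NOT a string tension;
NOT Yang–Mills-summit-bearing (barriers `FixedCouplingUltralocality`, `PerturbativeInvisibility`).
Family `N1c2D3` (1449 variables, 18 reduced blocks of dimensions `dimL`, max 25; signature sha256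
`9d78479e4706739c41f88e287ecc11ab8d1a828c4eed4296df1dbd18b262bc26`): the β-independent kernel checks of `Certificates/SparseReduced(Trace).lean`, run ONCE for
every certificate of the family — `dimCheck` (entries outside a block's own dimension are empty), `shapeCheck`
(positions in range, strictly sorted ⇒ duplicate-free), `entCoverCheck` (every term of every entry is listed under its
variable) — held by `N1c2D3TabA`, `N1c2D3TabB` and assembled (`shape`, `cover`) in `N1c2D3Tab`.
Nothing is claimed about lattice gauge theory in this file.
-/

namespace Summit.QuantumFields.GaugeBoot.Certificates.N1c2D3

noncomputable section

open Matrix Summit.QuantumFields.GaugeBoot.Certificates.Sparse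

/-- Position lists in range and duplicate-free for all 1449 variables. -/
theorem shape : ShapeOK P2 33 18 25 0 1449 := ((((((((shapeOK_of_check shape_0).append (shapeOK_of_check shape_1)).append (shapeOK_of_check shape_2)).append (shapeOK_of_check shape_3)).append (shapeOK_of_check shape_4)).append (shapeOK_of_check shape_5)).append (shapeOK_of_check shape_6)).append (shapeOK_of_check shape_7)).append (shapeOK_of_check shape_8)

/-- Every term of every block entry is listed under its variable, all 18 blocks. -/
theorem cover : EntCoverOK EB P2 33 25 0 18 := ((((((((((((entCoverOK_of_check cover_0).append (entCoverOK_of_check cover_1)).append (entCoverOK_of_check cover_2)).append (entCoverOK_of_check cover_3)).append (entCoverOK_of_check cover_4)).append (entCoverOK_of_check cover_5)).append (entCoverOK_of_check cover_6)).append (entCoverOK_of_check cover_7)).append (entCoverOK_of_check cover_8)).append (entCoverOK_of_check cover_9)).append (entCoverOK_of_check cover_10)).append (entCoverOK_of_check cover_11)).append (entCoverOK_of_check cover_12)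

/-! ## Interface (what a lattice binding consumes) -/

/-- Dimension of reduced block `k`. -/
def dim (k : Fin 18) : ℕ := dimL.getD k.val 0

/-- The combination `[(w, c), …]` at entry `(i, j)` of reduced block `k` (symmetric; the problem file's
`psd_blocks[k].entries["min(i,j),max(i,j)"]`; empty outside the block). -/
def ent (k : Fin 18) (i j : ℕ) : List (ℕ × ℤ) := Sparse.ent EB k.val i j

/-- **Reduced block `k` as a real matrix-valued linear form** in its own dimension `dim k`. -/
def redBlock (k : Fin 18) (y : Fin 1449 → ℝ) : Matrix (Fin (dim k)) (Fin (dim k)) ℝ :=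
  Sparse.redE EB k.val (dim k) 1449 y

/-- `redBlock` unfolds to `Sparse.redE` (the form used by the certificate modules). -/
theorem redBlock_eq (k : Fin 18) (y : Fin 1449 → ℝ) :
    redBlock k y = Sparse.redE EB k.val (dimL.getD k.val 0) 1449 y := rfl

/-- **Binding interface**: `redBlock k y i j = Σ_{(w,c) ∈ ent k i j} c · y_w`. -/
theorem redBlock_apply (k : Fin 18) (y : Fin 1449 → ℝ) (i j : Fin (dim k)) :
    redBlock k y i j = Sparse.evalComb (ent k i.val j.val) y := rfl

end

end Summit.QuantumFields.GaugeBoot.Certificates.N1c2D3
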